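import Summits.QuantumFields.BalabanUV.T4Continuum.Support.DirichletDipCutoffAxis

/-!
# `BalabanUV.T4Continuum.Support.DirichletCornerCutout` — NE2 (node U1a) formalisation swarm, sub-row `T4-U1a.S-NE2-D1-DIRICHLET°`, supplier item
# «Δ1-SKELETON» (file 8): THE SMOOTH INDICATOR `η` OF THE CORNER CELLS — three axis profiles with a plateau of radius `R′` and a ramp of
# width `R` (the two-sided thin slab `Dp` around the face planes of a range, the one-sided slab `Hp` around the bottom plane, the range-with-collar
# `Ep`), the corner bumps `Cb β κ₁ κ₂ = Π_λ (profile along λ)` and **`etaC = 1 − Π_{β,κ₁,κ₂} (1 − [β is −μ-exposed, κ₁ ≠ κ₂ transversal]·Cb)`**,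
# with its range and its UNCONDITIONAL smoothness `|Δ etaC| ≤ ℓ₁′`, `|Δ² etaC| ≤ ℓ₂′` at every site
# (unit b2b-balaban-t4-ne2-formalise-leaf-08, gen 7, file 8)

HONEST FRAMING.  Rung (B)+1 bookkeeping at MODEL level, finite torus; pure lattice combinatorics; NE2 (U1a) is NOT proved by this file;
spine PROVED 0/9 unchanged; NOT infinite volume, NOT the mass gap, NOT Clay.  HONEST DEPENDENCY (verbatim): «continuum YM on T⁴ ⇐ BetaPertH ∧
nine spine estimates (0/9 proved); BetaPertH ⇐ (D1) ∧ (D4) ∧ CAP+tail; G-an2-4 gates asym, D1 and NE2/3/4.»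

WHAT THIS FILE PROVES (0 sorry; file 4's `AxisSmooth` ∕ `liftA` BY NAME).  §1 the three profiles and their `AxisSmooth` instances (`2 ≤ R`,
`2 ≤ R′`, `2(R′ + R) ≤ n`; `Hp` needs `1 ≠ 0` in `ZMod (M μ)`, automatic for exposed blocks), their ranges.  §2 `Cb`, `etaC`, `0 ≤ · ≤ 1`,
**`etaC_eq_one_of_Cb`** (one saturated bump saturates `etaC`).  §3 smoothness: each factor `1 − [·]·Cb` steps by `≤ 2·lip1 R` and bends by
`≤ 2·lip2 R` along every axis (only the profile along the axis of motion moves), at most `3^d·d²` factors are active on a triple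
(`AsetC`), hence **`etaC_step`**, **`etaC_second`** with `ℓ₁′ = 3·3^d·d²·(2·lip1 R)`, `ℓ₂′ = 3·3^d·d²·(2·lip2 R) + 2ℓ₁′²`, at EVERY site of the torus.

ABSOLUTE RULE (cell, verbatim): «No internally-minted statement may enter as a cited fact. Every hypothesis is either kernel-proved in
this package or a verbatim quotation of a PUBLISHED theorem with page reference. The manuscript(s) under audit are NOT citable for
their own disputed steps — they are the thing under adjudication; programme-internal (2001/route/tribunal) claims are never citable.»
[folklore] lattice bookkeeping; data definitions; no `def … : Prop` fact.  NOT CLAIMED: that `etaC = 1` on the corner neighbourhoods (next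
file), the two-level law; NE2; NE3.
-/

noncomputable section

open scoped BigOperators
open Finset

namespace Summit.QuantumFields.BalabanUV.T4Continuum.DirichletCornerCutout

open Literature.MathematicalPhysics.QuantumFieldTheory.Balaban1983to89.B5Prop11Plancherel (Tor fine unitVec)
open Literature.MathematicalPhysics.QuantumFieldTheory.Balaban1983to89.B5Blocks16 (blockOf)
open Summit.QuantumFields.BalabanUV.T4Continuum.DirichletMonotoneCutoff (offsF blockOf_offsF_add_of_lt blockOf_offsF_add_of_eq blockOf_offsF_sub)
open Summit.QuantumFields.BalabanUV.T4Continuum.ScaleProfile (qprof qprof_mem qprof_eq_one qprof_eq_zero lip1 lip2 lip1_nonneg lip2_nonneg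
  qprof_step qprof_second' qprof_rev_step qprof_rev_second prod_mem abs_prod_sub_prod_le abs_prod_second_le sum_le_card_mul)
open Summit.QuantumFields.BalabanUV.T4Continuum.DirichletDipCutoff (BotExp)
open Summit.QuantumFields.BalabanUV.T4Continuum.DirichletDipCutoffAxis (AxisSmooth liftA liftA_step liftA_second liftA_add_of_ne liftA_sub_of_ne
  add_unitVec_self add_unitVec_ne sub_unitVec_self sub_unitVec_ne)

variable {d : ℕ}

/-! ## §1 The three profiles with plateau `R′` and ramp `R` -/

section Profiles

variable {n : ℕ} (R R' : ℕ)

/-- the ONE-SIDED SLAB around the plane below the range `c`: `q′(t)` inside `c`, `q′(n−1−t)` inside `c − 1`. [folklore] -/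
def Hp {m : ℕ} (c b : ZMod m) (t : ℕ) : ℝ := if b = c then qprof R R' t else if b = c - 1 then qprof R R' (n - 1 - t) else 0

/-- the TWO-SIDED THIN SLAB around both face planes of the range `c`. [folklore] -/
def Dp {m : ℕ} (c b : ZMod m) (t : ℕ) : ℝ :=
  if b = c then qprof R R' t + qprof R R' (n - 1 - t)
  else (if b = c + 1 then qprof R R' t else 0) + (if b = c - 1 then qprof R R' (n - 1 - t) else 0)

/-- the RANGE WITH COLLAR: `1` on the range `c`, collars of plateau `R′` outside. [folklore] -/
def Ep {m : ℕ} (c b : ZMod m) (t : ℕ) : ℝ :=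
  if b = c then 1 else (if b = c + 1 then qprof R R' t else 0) + (if b = c - 1 then qprof R R' (n - 1 - t) else 0)

variable {R R'}

/-- plateau and far values of `q′ = qprof R R′`. [folklore] -/
theorem q_values' (hR : 2 ≤ R) (hR' : 2 ≤ R') (hn : 2 * (R' + R) ≤ n) : qprof R R' 0 = 1 ∧ qprof R R' 1 = 1 ∧ qprof R R' 2 = 1 ∧ qprof R R' (n - 2) = 0 ∧ qprof R R' (n - 1) = 0 ∧ qprof R R' n = 0 :=
  ⟨qprof_eq_one R' (by omega) (by omega), qprof_eq_one R' (by omega) (by omega), qprof_eq_one R' (by omega) hR',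
    qprof_eq_zero hR R' (by omega), qprof_eq_zero hR R' (by omega), qprof_eq_zero hR R' (by omega)⟩

/-- the two terms of a two-sided profile have disjoint supports: `q′(t) = 0 ∨ q′(n−1−t) = 0` (`t < n`). [folklore] -/
theorem q_disjoint' (hR : 2 ≤ R) (hn : 2 * (R' + R) ≤ n) {t : ℕ} (ht : t < n) : qprof R R' t = 0 ∨ qprof R R' (n - 1 - t) = 0 := by
  by_cases h : R' + R ≤ t + 1
  · exact Or.inl (qprof_eq_zero hR R' h)
  · exact Or.inr (qprof_eq_zero hR R' (by omega))

/-- `0 ≤ q′(t) + q′(n−1−t) ≤ 1` for `t < n`. [folklore] -/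
theorem two_sided_mem (hR : 2 ≤ R) (hn : 2 * (R' + R) ≤ n) {t : ℕ} (ht : t < n) : 0 ≤ qprof R R' t + qprof R R' (n - 1 - t) ∧ qprof R R' t + qprof R R' (n - 1 - t) ≤ 1 := by
  have h1 := qprof_mem hR R' t
  have h2 := qprof_mem hR R' (n - 1 - t)
  rcases q_disjoint' hR hn ht with h | h <;> rw [h] <;> constructor <;> linarith [h1.1, h1.2, h2.1, h2.2]

/-- `0 ≤ Hp ≤ 1`. [folklore] -/
theorem Hp_mem (hR : 2 ≤ R) {m : ℕ} (c b : ZMod m) (t : ℕ) : 0 ≤ Hp (n := n) R R' c b t ∧ Hp (n := n) R R' c b t ≤ 1 := by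
  unfold Hp; split_ifs
  · exact qprof_mem hR R' _
  · exact qprof_mem hR R' _
  · exact ⟨le_rfl, zero_le_one⟩

/-- `0 ≤ Dp ≤ 1` at offsets `t < n`. [folklore] -/
theorem Dp_mem (hR : 2 ≤ R) (hn : 2 * (R' + R) ≤ n) {m : ℕ} (c b : ZMod m) {t : ℕ} (ht : t < n) : 0 ≤ Dp (n := n) R R' c b t ∧ Dp (n := n) R R' c b t ≤ 1 := by
  have h12 := two_sided_mem hR hn ht
  have h1 := qprof_mem hR R' t
  have h2 := qprof_mem hR R' (n - 1 - t)
  unfold Dp; split_ifs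
  · exact h12
  · exact h12
  · rw [add_zero]; exact h1
  · rw [zero_add]; exact h2
  · norm_num

/-- `0 ≤ Ep ≤ 1` at offsets `t < n`. [folklore] -/
theorem Ep_mem (hR : 2 ≤ R) (hn : 2 * (R' + R) ≤ n) {m : ℕ} (c b : ZMod m) {t : ℕ} (ht : t < n) : 0 ≤ Ep (n := n) R R' c b t ∧ Ep (n := n) R R' c b t ≤ 1 := by
  have h12 := two_sided_mem hR hn ht
  have h1 := qprof_mem hR R' t
  have h2 := qprof_mem hR R' (n - 1 - t)
  unfold Ep; split_ifs
  · exact ⟨zero_le_one, le_rfl⟩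
  · exact h12
  · rw [add_zero]; exact h1
  · rw [zero_add]; exact h2
  · norm_num

/-- a one-term indicator profile: steps. [folklore] -/
theorem abs_ite_step (hR : 2 ≤ R) (P : Prop) [Decidable P] (u v : ℝ) (h : |u - v| ≤ lip1 R) : |(if P then u else 0) - (if P then v else 0)| ≤ lip1 R := by
  split_ifs
  · exact h
  · rw [sub_self, abs_zero]; exact lip1_nonneg hR

/-- a one-term indicator profile: second differences. [folklore] -/
theorem abs_ite_second (P : Prop) [Decidable P] (u v w : ℝ) (h : |2 * u - v - w| ≤ lip2 R) :
    |2 * (if P then u else 0) - (if P then v else 0) - (if P then w else 0)| ≤ lip2 R := by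
  split_ifs
  · exact h
  · norm_num; exact lip2_nonneg

/-- **`Hp` is an axis profile** (`lip1`, `lip2`) when `1 ≠ 0` in `ZMod m`. [folklore] -/
theorem axisSmooth_Hp (hR : 2 ≤ R) (hR' : 2 ≤ R') (hn : 2 * (R' + R) ≤ n) {m : ℕ} (h10 : (1 : ZMod m) ≠ 0) (c : ZMod m) : AxisSmooth n (Hp (n := n) R R' c) (lip1 R) (lip2 R) := by
  obtain ⟨q0, q1, q2, qn2, qn1, qn⟩ := q_values' (n := n) hR hR' hn
  have hcc : c - 1 ≠ c := fun h => h10 (by have := congrArg (fun z => c - z) h; simpa using this)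
  have hl1 := lip1_nonneg hR
  have hl2 : 0 ≤ lip2 R := lip2_nonneg
  refine ⟨hl1, hl2, fun b t ht => ?_, fun b t ht => ?_, fun b => ?_, fun b => ?_, fun b => ?_⟩
  · unfold Hp
    by_cases h1 : b = c
    · simp only [if_pos h1]; exact qprof_step hR R' t
    · by_cases h2 : b = c - 1
      · simp only [if_neg h1, if_pos h2]; exact qprof_rev_step hR R' (n - 1) t
      · simp only [if_neg h1, if_neg h2, sub_self, abs_zero]; exact hl1
  · unfold Hp
    by_cases h1 : b = c
    · simp only [if_pos h1]; exact qprof_second' hR R' t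
    · by_cases h2 : b = c - 1
      · simp only [if_neg h1, if_pos h2]
        have := qprof_rev_second hR R' (K := n - 1) (i := t) (by omega)
        rw [show 2 * qprof R R' (n - 1 - (t + 1)) - qprof R R' (n - 1 - (t + 2)) - qprof R R' (n - 1 - t)
            = -(qprof R R' (n - 1 - (t + 2)) - 2 * qprof R R' (n - 1 - (t + 1)) + qprof R R' (n - 1 - t)) by ring, abs_neg]
        exact this
      · simp only [if_neg h1, if_neg h2]; norm_num; exact hl2
  · -- cross: both sides equal `[b = c − 1]`
    have e2 : (b + 1 = c) ↔ (b = c - 1) := ⟨fun h => by rw [← h, add_sub_cancel_right], fun h => by rw [h, sub_add_cancel]⟩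
    have lhs : Hp (n := n) R R' c (b + 1) 0 = if b = c - 1 then 1 else 0 := by
      unfold Hp
      by_cases h : b + 1 = c
      · rw [if_pos h, if_pos (e2.1 h), q0]
      · rw [if_neg h, if_neg (fun h' => h (e2.2 h'))]
        split_ifs
        · rw [Nat.sub_zero, qn1]
        · rfl
    have rhs : Hp (n := n) R R' c b (n - 1) = if b = c - 1 then 1 else 0 := by
      unfold Hp
      by_cases h : b = c
      · rw [if_pos h, qn1, if_neg (fun h' => hcc (by rw [← h', h]))]
      · rw [if_neg h]
        split_ifs
        · rw [Nat.sub_self, q0]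
        · rfl
    rw [lhs, rhs]
  · unfold Hp; split_ifs
    · rw [q1, q0]
    · rw [show n - 1 - 1 = n - 2 by omega, Nat.sub_zero, qn2, qn1]
    · rfl
  · unfold Hp; split_ifs
    · rw [qn1, qn2]
    · rw [Nat.sub_self, show n - 1 - (n - 2) = 1 by omega, q0, q1]
    · rfl

/-- **`Dp` is an axis profile** (`2·lip1`, `2·lip2`), every `m`. [folklore] -/
theorem axisSmooth_Dp (hR : 2 ≤ R) (hR' : 2 ≤ R') (hn : 2 * (R' + R) ≤ n) {m : ℕ} (c : ZMod m) : AxisSmooth n (Dp (n := n) R R' c) (2 * lip1 R) (2 * lip2 R) := by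
  obtain ⟨q0, q1, q2, qn2, qn1, qn⟩ := q_values' (n := n) hR hR' hn
  have hl1 := lip1_nonneg hR
  have hl2 : 0 ≤ lip2 R := lip2_nonneg
  have e1 : ∀ b : ZMod m, (b + 1 = c + 1) ↔ (b = c) := fun b => ⟨fun h => add_right_cancel h, fun h => by rw [h]⟩
  have e2 : ∀ b : ZMod m, (b + 1 = c) ↔ (b = c - 1) := fun b =>
    ⟨fun h => by rw [← h, add_sub_cancel_right], fun h => by rw [h, sub_add_cancel]⟩
  refine ⟨by positivity, by positivity, fun b t ht => ?_, fun b t ht => ?_, fun b => ?_, fun b => ?_, fun b => ?_⟩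
  · have hA := qprof_step hR R' t
    have hB := qprof_rev_step hR R' (n - 1) t
    unfold Dp
    by_cases h0 : b = c
    · simp only [if_pos h0]
      calc |qprof R R' (t + 1) + qprof R R' (n - 1 - (t + 1)) - (qprof R R' t + qprof R R' (n - 1 - t))|
          = |(qprof R R' (t + 1) - qprof R R' t) + (qprof R R' (n - 1 - (t + 1)) - qprof R R' (n - 1 - t))| := by ring_nf
        _ ≤ lip1 R + lip1 R := (abs_add_le _ _).trans (add_le_add hA hB)
        _ = 2 * lip1 R := by ring
    · simp only [if_neg h0]
      have hA' := abs_ite_step hR (b = c + 1) _ _ hA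
      have hB' := abs_ite_step hR (b = c - 1) _ _ hB
      calc |(if b = c + 1 then qprof R R' (t + 1) else 0) + (if b = c - 1 then qprof R R' (n - 1 - (t + 1)) else 0)
              - ((if b = c + 1 then qprof R R' t else 0) + (if b = c - 1 then qprof R R' (n - 1 - t) else 0))|
          = |((if b = c + 1 then qprof R R' (t + 1) else 0) - (if b = c + 1 then qprof R R' t else 0))
              + ((if b = c - 1 then qprof R R' (n - 1 - (t + 1)) else 0) - (if b = c - 1 then qprof R R' (n - 1 - t) else 0))| := by ring_nf
        _ ≤ lip1 R + lip1 R := (abs_add_le _ _).trans (add_le_add hA' hB')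
        _ = 2 * lip1 R := by ring
  · have hA := qprof_second' hR R' t
    have hB : |2 * qprof R R' (n - 1 - (t + 1)) - qprof R R' (n - 1 - (t + 2)) - qprof R R' (n - 1 - t)| ≤ lip2 R := by
      have := qprof_rev_second hR R' (K := n - 1) (i := t) (by omega)
      rw [show 2 * qprof R R' (n - 1 - (t + 1)) - qprof R R' (n - 1 - (t + 2)) - qprof R R' (n - 1 - t)
          = -(qprof R R' (n - 1 - (t + 2)) - 2 * qprof R R' (n - 1 - (t + 1)) + qprof R R' (n - 1 - t)) by ring, abs_neg]
      exact this
    unfold Dp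
    by_cases h0 : b = c
    · simp only [if_pos h0]
      calc |2 * (qprof R R' (t + 1) + qprof R R' (n - 1 - (t + 1))) - (qprof R R' (t + 2) + qprof R R' (n - 1 - (t + 2)))
              - (qprof R R' t + qprof R R' (n - 1 - t))|
          = |(2 * qprof R R' (t + 1) - qprof R R' (t + 2) - qprof R R' t)
              + (2 * qprof R R' (n - 1 - (t + 1)) - qprof R R' (n - 1 - (t + 2)) - qprof R R' (n - 1 - t))| := by ring_nf
        _ ≤ lip2 R + lip2 R := (abs_add_le _ _).trans (add_le_add hA hB)
        _ = 2 * lip2 R := by ring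
    · simp only [if_neg h0]
      have hA' := abs_ite_second (b = c + 1) _ _ _ hA
      have hB' := abs_ite_second (b = c - 1) _ _ _ hB
      calc |2 * ((if b = c + 1 then qprof R R' (t + 1) else 0) + (if b = c - 1 then qprof R R' (n - 1 - (t + 1)) else 0))
            - ((if b = c + 1 then qprof R R' (t + 2) else 0) + (if b = c - 1 then qprof R R' (n - 1 - (t + 2)) else 0))
            - ((if b = c + 1 then qprof R R' t else 0) + (if b = c - 1 then qprof R R' (n - 1 - t) else 0))|
          = |(2 * (if b = c + 1 then qprof R R' (t + 1) else 0) - (if b = c + 1 then qprof R R' (t + 2) else 0)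
              - (if b = c + 1 then qprof R R' t else 0))
            + (2 * (if b = c - 1 then qprof R R' (n - 1 - (t + 1)) else 0) - (if b = c - 1 then qprof R R' (n - 1 - (t + 2)) else 0)
              - (if b = c - 1 then qprof R R' (n - 1 - t) else 0))| := by ring_nf
        _ ≤ lip2 R + lip2 R := (abs_add_le _ _).trans (add_le_add hA' hB')
        _ = 2 * lip2 R := by ring
  · -- cross: both sides equal `[b = c ∨ b = c − 1]`
    have lhs : Dp (n := n) R R' c (b + 1) 0 = if b = c ∨ b = c - 1 then 1 else 0 := by
      unfold Dp
      rw [Nat.sub_zero, qn1, q0]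
      by_cases h : b + 1 = c
      · rw [if_pos h, if_pos (Or.inr ((e2 b).1 h))]; norm_num
      · rw [if_neg h]
        by_cases h' : b = c
        · rw [if_pos ((e1 b).2 h'), if_pos (Or.inl h')]; split_ifs <;> norm_num
        · have hn1 : ¬ (b + 1 = c + 1) := fun h'' => h' ((e1 b).1 h'')
          have hn2 : ¬ (b = c ∨ b = c - 1) := by
            rintro (h3 | h3)
            · exact h' h3
            · exact h ((e2 b).2 h3)
          rw [if_neg hn1, if_neg hn2]; split_ifs <;> norm_num
    have rhs : Dp (n := n) R R' c b (n - 1) = if b = c ∨ b = c - 1 then 1 else 0 := by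
      unfold Dp
      rw [Nat.sub_self, qn1, q0]
      by_cases h : b = c
      · rw [if_pos h, if_pos (Or.inl h)]; norm_num
      · rw [if_neg h]
        by_cases h' : b = c - 1
        · rw [if_pos h', if_pos (Or.inr h')]; split_ifs <;> norm_num
        · have hn2 : ¬ (b = c ∨ b = c - 1) := by
            rintro (h3 | h3)
            · exact h h3
            · exact h' h3
          rw [if_neg h', if_neg hn2]; split_ifs <;> norm_num
    rw [lhs, rhs]
  · unfold Dp
    rw [show n - 1 - 1 = n - 2 by omega, Nat.sub_zero, q1, q0, qn2, qn1]
  · unfold Dp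
    rw [Nat.sub_self, show n - 1 - (n - 2) = 1 by omega, qn1, qn2, q0, q1]

/-- **`Ep` is an axis profile** (`2·lip1`, `2·lip2`), every `m`. [folklore] -/
theorem axisSmooth_Ep (hR : 2 ≤ R) (hR' : 2 ≤ R') (hn : 2 * (R' + R) ≤ n) {m : ℕ} (c : ZMod m) : AxisSmooth n (Ep (n := n) R R' c) (2 * lip1 R) (2 * lip2 R) := by
  obtain ⟨q0, q1, q2, qn2, qn1, qn⟩ := q_values' (n := n) hR hR' hn
  have hl1 := lip1_nonneg hR
  have hl2 : 0 ≤ lip2 R := lip2_nonneg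
  have e1 : ∀ b : ZMod m, (b + 1 = c + 1) ↔ (b = c) := fun b => ⟨fun h => add_right_cancel h, fun h => by rw [h]⟩
  have e2 : ∀ b : ZMod m, (b + 1 = c) ↔ (b = c - 1) := fun b =>
    ⟨fun h => by rw [← h, add_sub_cancel_right], fun h => by rw [h, sub_add_cancel]⟩
  refine ⟨by positivity, by positivity, fun b t ht => ?_, fun b t ht => ?_, fun b => ?_, fun b => ?_, fun b => ?_⟩
  · unfold Ep
    by_cases h0 : b = c
    · simp only [if_pos h0, sub_self, abs_zero]; positivity
    · simp only [if_neg h0]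
      have hA' := abs_ite_step hR (b = c + 1) _ _ (qprof_step hR R' t)
      have hB' := abs_ite_step hR (b = c - 1) _ _ (qprof_rev_step hR R' (n - 1) t)
      calc |(if b = c + 1 then qprof R R' (t + 1) else 0) + (if b = c - 1 then qprof R R' (n - 1 - (t + 1)) else 0)
              - ((if b = c + 1 then qprof R R' t else 0) + (if b = c - 1 then qprof R R' (n - 1 - t) else 0))|
          = |((if b = c + 1 then qprof R R' (t + 1) else 0) - (if b = c + 1 then qprof R R' t else 0))
              + ((if b = c - 1 then qprof R R' (n - 1 - (t + 1)) else 0) - (if b = c - 1 then qprof R R' (n - 1 - t) else 0))| := by ring_nf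
        _ ≤ lip1 R + lip1 R := (abs_add_le _ _).trans (add_le_add hA' hB')
        _ = 2 * lip1 R := by ring
  · unfold Ep
    by_cases h0 : b = c
    · simp only [if_pos h0]; norm_num; positivity
    · simp only [if_neg h0]
      have hB : |2 * qprof R R' (n - 1 - (t + 1)) - qprof R R' (n - 1 - (t + 2)) - qprof R R' (n - 1 - t)| ≤ lip2 R := by
        have := qprof_rev_second hR R' (K := n - 1) (i := t) (by omega)
        rw [show 2 * qprof R R' (n - 1 - (t + 1)) - qprof R R' (n - 1 - (t + 2)) - qprof R R' (n - 1 - t)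
            = -(qprof R R' (n - 1 - (t + 2)) - 2 * qprof R R' (n - 1 - (t + 1)) + qprof R R' (n - 1 - t)) by ring, abs_neg]
        exact this
      have hA' := abs_ite_second (b = c + 1) _ _ _ (qprof_second' hR R' t)
      have hB' := abs_ite_second (b = c - 1) _ _ _ hB
      calc |2 * ((if b = c + 1 then qprof R R' (t + 1) else 0) + (if b = c - 1 then qprof R R' (n - 1 - (t + 1)) else 0))
            - ((if b = c + 1 then qprof R R' (t + 2) else 0) + (if b = c - 1 then qprof R R' (n - 1 - (t + 2)) else 0))
            - ((if b = c + 1 then qprof R R' t else 0) + (if b = c - 1 then qprof R R' (n - 1 - t) else 0))|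
          = |(2 * (if b = c + 1 then qprof R R' (t + 1) else 0) - (if b = c + 1 then qprof R R' (t + 2) else 0)
              - (if b = c + 1 then qprof R R' t else 0))
            + (2 * (if b = c - 1 then qprof R R' (n - 1 - (t + 1)) else 0) - (if b = c - 1 then qprof R R' (n - 1 - (t + 2)) else 0)
              - (if b = c - 1 then qprof R R' (n - 1 - t) else 0))| := by ring_nf
        _ ≤ lip2 R + lip2 R := (abs_add_le _ _).trans (add_le_add hA' hB')
        _ = 2 * lip2 R := by ring
  · have lhs : Ep (n := n) R R' c (b + 1) 0 = if b = c ∨ b = c - 1 then 1 else 0 := by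
      unfold Ep
      rw [Nat.sub_zero, qn1, q0]
      by_cases h : b + 1 = c
      · rw [if_pos h, if_pos (Or.inr ((e2 b).1 h))]
      · rw [if_neg h]
        by_cases h' : b = c
        · rw [if_pos ((e1 b).2 h'), if_pos (Or.inl h')]; split_ifs <;> norm_num
        · have hn1 : ¬ (b + 1 = c + 1) := fun h'' => h' ((e1 b).1 h'')
          have hn2 : ¬ (b = c ∨ b = c - 1) := by
            rintro (h3 | h3)
            · exact h' h3
            · exact h ((e2 b).2 h3)
          rw [if_neg hn1, if_neg hn2]; split_ifs <;> norm_num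
    have rhs : Ep (n := n) R R' c b (n - 1) = if b = c ∨ b = c - 1 then 1 else 0 := by
      unfold Ep
      rw [Nat.sub_self, qn1, q0]
      by_cases h : b = c
      · rw [if_pos h, if_pos (Or.inl h)]
      · rw [if_neg h]
        by_cases h' : b = c - 1
        · rw [if_pos h', if_pos (Or.inr h')]; split_ifs <;> norm_num
        · have hn2 : ¬ (b = c ∨ b = c - 1) := by
            rintro (h3 | h3)
            · exact h h3
            · exact h' h3
          rw [if_neg h', if_neg hn2]; split_ifs <;> norm_num
    rw [lhs, rhs]
  · unfold Ep
    rw [show n - 1 - 1 = n - 2 by omega, Nat.sub_zero, q1, q0, qn2, qn1]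
  · unfold Ep
    rw [Nat.sub_self, show n - 1 - (n - 2) = 1 by omega, qn1, qn2, q0, q1]

end Profiles

end Summit.QuantumFields.BalabanUV.T4Continuum.DirichletCornerCutout

end
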